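import Summits.AtomisticToContinuum.HydrodynamicLimit.Theses.AntiMazurCoboundaries
import Summits.AtomisticToContinuum.HydrodynamicLimit.Theses.FluxGibbsianityLdDrude
import Summits.AtomisticToContinuum.HydrodynamicLimit.Theorems.JParityClosureOddContactSymmetryGibbsInvariance
import Literature.MathematicalPhysics.KineticTheory.HardSphereTwoTimePressure
import Literature.MathematicalPhysics.KineticTheory.HardBallErgodicity
import Literature.MathematicalPhysics.KineticTheory.HardSphereWindowPressureStatic
import Literature.Analysis.FluidPDE.HardSphereFlowJointMeasurable
import HarnessLib

/-!
# Objects of the crux line `self-tilted-edge-covariance` (crux `KineticFluxLdDecay`,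
# stmt-AtomisticToContinuum-10967; routes AntiMazurCoboundaries r4 / FluxGibbsianityLdDrude r2)

Objects module of the registered skeleton `Cruxes/KineticFluxLdDecay/Lines/self-tilted-edge-covariance.lean`:
the frame abbreviations, the SELF-TILTED objects of the line over the forward window `[0, u]`
(`pathInt`, `tiltWeight`, `tiltMean`, `edgeCov`, `edgeCum`, `fejerInt`), the statements of the registered
stubs (`SelfTiltIdentity`, `QuadraticShadow`, `TiltedCumulantComparison`, `SquareWindowMonotone`,
`TiltedThirdCumulantSublinear`) and a small junk-free API (positivity/bounds/measurability), moved into ONE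
importable `Theorems` module so that the stub helper files of the line (one per registered stub,
`--supports stmt-AtomisticToContinuum-10967`) and the closing file share a single copy of every definition.

The lever (exact, finite `N`, every flow; DemboZeitouni2010 §2.3/§4.5 for tilted laws, Jakšić–Pillet–Rey-Bellet
arXiv:1009.3248 for Green–Kubo from LD generating functions of deterministic systems): with
`J_u(z) = ∫₀ᵘ F(Φ_r z) dr` and `μ^{β,u} ∝ e^{βJ_u} μ` (`μ` flow-invariant),
`log E_μ e^{βJ_h} = βh E_μF + β² ∫₀ʰ∫₀ˢ Cov_{μ^{β,u}}(F∘Φ_u, F) du ds`; the crux's functional is the member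
`β = 1/h`, the L² shadow (item 10952) the member `β = 0`; `∂_β Cov_{μ^{β,u}}(F∘Φ_u, F)` is the joint third
cumulant `κ₃^{μ^{β,u}}(F∘Φ_u, F, J_u)`, whence the criterion
`10967 ⟸ 10952 ∧ [sup_{u ≤ h, β ≤ 1/h} (N+1)⁻¹|κ₃| = o(h) uniformly in N]`.

Design: every time quantity is over the FORWARD window `[0,u]` (no negative times in any statement); all
expectations are Bochner integrals against a probability law `μ` carried by `Φ.good` (junk off `good` is
`μ`-null); `tiltMean` is a ratio whose denominator is `> 0` for bounded `F` (`tiltWeight_pos`). Not here: any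
dynamics-specific estimate (those are the stubs).
-/

noncomputable section

open MeasureTheory ProbabilityTheory Set Filter
open scoped ENNReal

namespace Summit.AtomisticToContinuum.HydrodynamicLimit.Theorems.SelfTilt

open Literature.MathematicalPhysics.KineticTheory (T3 V3 hsDiameter localGibbsLaw)
open Literature.Analysis.FluidPDE (HardSphereFlow Config)

/-! ## Frame abbreviations (all reducible; the crux decls are matched by unfolding) -/

/-- Hard-sphere flows of `n` spheres of diameter `ε` on `𝕋³` (abstract frame of the identities). -/
abbrev TFlow (ε : ℝ) (n : ℕ) : Type :=
  HardSphereFlow (Literature.Analysis.FluidPDE.Torus.geometry (Fin 3)) ε n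

/-- Phase space of `n` spheres on `𝕋³`. -/
abbrev TPhase (n : ℕ) : Type := Config n (Fin 3) T3

/-- The crux's flows: `N + 1` spheres of reduced diameter `σ`, i.e. diameter `σ (N+1)^{-1/3}`. -/
abbrev Flow (σ : ℝ) (N : ℕ) : Type := TFlow (hsDiameter σ N) (N + 1)

/-- The crux's phase space. -/
abbrev Phase (N : ℕ) : Type := TPhase (N + 1)

/-- The flow-invariant global Gibbs law `G_N` of the crux (constant profiles `a, u₀, θ`). -/
abbrev gibbs (σ a θ : ℝ) (u₀ : V3) (N : ℕ) (Φ : Flow σ N) : Measure (Phase N) :=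
  localGibbsLaw σ (fun _ => a) (fun _ => u₀) (fun _ => θ) N Φ

/-- The fast one-body observable `F(z) = Σᵢ φ(xᵢ) g((vᵢ − u₀)/√θ)` of the crux. -/
abbrev fluxObs (θ : ℝ) (u₀ : V3) (φ : T3 → ℝ) (g : V3 → ℝ) (N : ℕ) (z : Phase N) : ℝ :=
  ∑ i, φ (z i).1 * g ((Real.sqrt θ)⁻¹ • ((z i).2 - u₀))

/-- The kinetic window `h = τ (N+1)^{-1/3}` (macroscopic time of `τ × O(1)` mean free times). -/
abbrev window (τ : ℝ) (N : ℕ) : ℝ := τ * ((N + 1 : ℕ) : ℝ) ^ (-(1 / 3 : ℝ))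

/-- The crux's orthogonality clause `g ⊥ span{1, v, |v|²}` in `L²(stdGaussian ℝ³)`. -/
abbrev Orthogonal (g : V3 → ℝ) : Prop :=
  ∀ (c₀ c₂ : ℝ) (b : V3),
    ∫ v, g v * (c₀ + inner ℝ b v + c₂ * ‖v‖ ^ 2) ∂(ProbabilityTheory.stdGaussian V3) = 0

/-! ## The self-tilted objects of the line (forward window `[0, u]`) -/

section Tilt

variable {ε : ℝ} {n : ℕ}

/-- Path integral of the observable along the orbit over the forward window: `J_u(z) = ∫₀ᵘ F(Φ_r z) dr`. -/
abbrev pathInt (Φ : TFlow ε n) (F : TPhase n → ℝ) (u : ℝ) (z : TPhase n) : ℝ :=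
  ∫ r in (0 : ℝ)..u, F (Φ.flow r z)

/-- The self-tilt weight `e^{β J_u(z)}` (density of `μ^{β,u}` w.r.t. `μ`, up to normalisation). -/
def tiltWeight (Φ : TFlow ε n) (F : TPhase n → ℝ) (β u : ℝ) (z : TPhase n) : ℝ :=
  Real.exp (β * pathInt Φ F u z)

/-- Expectation of an observable `X` under the SELF-TILTED law `μ^{β,u} = e^{βJ_u} μ / E_μ e^{βJ_u}`. -/
def tiltMean (Φ : TFlow ε n) (μ : Measure (TPhase n)) (F : TPhase n → ℝ) (β u : ℝ)
    (X : TPhase n → ℝ) : ℝ :=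
  (∫ z, X z * tiltWeight Φ F β u z ∂μ) / ∫ z, tiltWeight Φ F β u z ∂μ

/-- The EDGE COVARIANCE `𝒞_β(u) := Cov_{μ^{β,u}}(F∘Φ_u, F)`: covariance of the flux at the two ends of the
tilted window. At `β = 0` it is the equilibrium autocovariance `Cov_μ(F∘Φ_u, F)`. -/
def edgeCov (Φ : TFlow ε n) (μ : Measure (TPhase n)) (F : TPhase n → ℝ) (β u : ℝ) : ℝ :=
  tiltMean Φ μ F β u (fun z => F (Φ.flow u z) * F z) -
    tiltMean Φ μ F β u (fun z => F (Φ.flow u z)) * tiltMean Φ μ F β u F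

/-- The EDGE THIRD CUMULANT `K_β(u) := κ₃^{μ^{β,u}}(F∘Φ_u, F, J_u) = ∂_β 𝒞_β(u)`: the joint third cumulant,
under the self-tilted law, of the two edge fluxes and the path integral that tilts. -/
def edgeCum (Φ : TFlow ε n) (μ : Measure (TPhase n)) (F : TPhase n → ℝ) (β u : ℝ) : ℝ :=
  tiltMean Φ μ F β u (fun z => F (Φ.flow u z) * F z * pathInt Φ F u z)
    - tiltMean Φ μ F β u (fun z => F (Φ.flow u z) * F z) * tiltMean Φ μ F β u (pathInt Φ F u)
    - tiltMean Φ μ F β u (fun z => F (Φ.flow u z) * pathInt Φ F u z) * tiltMean Φ μ F β u F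
    - tiltMean Φ μ F β u (fun z => F z * pathInt Φ F u z) *
        tiltMean Φ μ F β u (fun z => F (Φ.flow u z))
    + 2 * tiltMean Φ μ F β u (fun z => F (Φ.flow u z)) * tiltMean Φ μ F β u F *
        tiltMean Φ μ F β u (pathInt Φ F u)

/-- The FEJÉR DOUBLE INTEGRAL `I_β(h) := ∫₀ʰ ∫₀ˢ 𝒞_β(u) du ds` (`= ∫₀ʰ (h − u) 𝒞_β(u) du`). -/
def fejerInt (Φ : TFlow ε n) (μ : Measure (TPhase n)) (F : TPhase n → ℝ) (β h : ℝ) : ℝ :=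
  ∫ s in (0 : ℝ)..h, ∫ u in (0 : ℝ)..s, edgeCov Φ μ F β u

end Tilt

/-! ## Statements of the registered stubs -/

/-- Statement of `stub_selfTiltIdentity` — **the self-tilted edge-covariance identity** (abstract: any hard-sphere
flow `Φ` on `𝕋³`, any `Φ`-invariant probability law `μ` carried by the good set, any bounded CONTINUOUS `F`):
for every real `β` and window `h > 0`, `E_μ exp(β J_h) = exp(β h E_μ F + β² I_β(h))`,
`I_β(h) = ∫₀ʰ∫₀ˢ 𝒞_β(u) du ds`, in the crux's `∫⁻ … ofReal` currency. Proof plan: `Z(s) := E_μ e^{βJ_s}`,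
`Nu(s) := E_μ[F e^{βJ_s}]`, `M(s) := E_μ[F∘Φ_s · F · e^{βJ_s}]`. Pathwise on good orbits `r ↦ F(Φ_r z)` is
right-continuous (`IsHardSphereTrajectory.tendsto_nhdsGT`) and continuous off the (locally finite) collision
times, so `e^{βJ_h} − 1 = β∫₀ʰ F(Φ_s z)e^{βJ_s(z)} ds` (FTC off a finite set); `μ`-average, Fubini and ONE shift
by the flow (`flow_add` on `good`, invariance) give `Z(s) = 1 + β∫₀ˢ Nu`, `Nu(s) = E_μ F + β∫₀ˢ M` and
`E_μ[F∘Φ_s e^{βJ_s}] = Nu(s)`; `Nu` is continuous so `Z ∈ C¹`, `log Z(h) = β∫₀ʰ Nu/Z`; and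
`Nu(s)/Z(s) − E_μF = β∫₀ˢ (M/Z − Nu²/Z²) = β∫₀ˢ 𝒞_β` by Fubini on the triangle against the `C¹` function
`1/Z` (no a.e. derivative of `Nu` is needed). -/
def SelfTiltIdentity : Prop :=
  ∀ (ε : ℝ) (n : ℕ) (Φ : TFlow ε n) (μ : Measure (TPhase n)), IsProbabilityMeasure μ →
    (∀ t, MeasurePreserving (Φ.flow t) μ μ) → μ Φ.goodᶜ = 0 →
    ∀ F : TPhase n → ℝ, Continuous F → (∃ C : ℝ, ∀ z, |F z| ≤ C) →
      ∀ (β h : ℝ), 0 < h →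
        ∫⁻ z, ENNReal.ofReal (Real.exp (β * pathInt Φ F h z)) ∂μ =
          ENNReal.ofReal (Real.exp (β * h * (∫ z, F z ∂μ) + β ^ 2 * fejerInt Φ μ F β h))

/-- Statement of `stub_quadraticShadow` — **the quadratic (`β = 0`) shadow of the identity**: same abstract data
with `F` bounded measurable; for `h > 0`, `E_μ (h⁻¹J_h)² = 2h⁻²I_0(h) + (E_μ F)²` in `∫⁻ … ofReal` currency
(Fubini, stationarity `E_μ[F∘Φ_s · F∘Φ_r] = E_μ[F∘Φ_{s−r} · F]` for `r ≤ s`, symmetry of the square,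
`E_μ J_h = h E_μ F`; at `β = 0` the tilt weight is `1` and `tiltMean` is the plain mean). -/
def QuadraticShadow : Prop :=
  ∀ (ε : ℝ) (n : ℕ) (Φ : TFlow ε n) (μ : Measure (TPhase n)), IsProbabilityMeasure μ →
    (∀ t, MeasurePreserving (Φ.flow t) μ μ) → μ Φ.goodᶜ = 0 →
    ∀ F : TPhase n → ℝ, Measurable F → (∃ C : ℝ, ∀ z, |F z| ≤ C) →
      ∀ h : ℝ, 0 < h →
        ∫⁻ z, ENNReal.ofReal ((h⁻¹ * pathInt Φ F h z) ^ 2) ∂μ =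
          ENNReal.ofReal (2 * h⁻¹ ^ 2 * fejerInt Φ μ F 0 h + (∫ z, F z ∂μ) ^ 2)

/-- Statement of `stub_tiltedCumulantComparison` — **the third-cumulant comparison (mean value theorem in the
tilt rate, integrated over the Fejér triangle)**: same abstract data (`F` bounded measurable); for `β ≥ 0`, `h > 0`
and any `K`, if `|κ₃^{μ^{β',u}}(F∘Φ_u, F, J_u)| ≤ K` for all `u ∈ [0,h]`, `β' ∈ [0,β]`, then
`I_β(h) ≤ I_0(h) + β K h²/2`. Proof plan: `β' ↦ E_μ[X e^{β'J_u}]` is differentiable (dominated differentiation;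
`X`, `J_u` bounded, a.e.-measurable) with derivative `E_μ[X J_u e^{β'J_u}]`, so `∂_β tiltMean_β[X] =
tiltMean[XJ_u] − tiltMean[X]tiltMean[J_u]` and `∂_β edgeCov = edgeCum` (joint-cumulant algebra); MVT on `[0,β]`;
`u ↦ edgeCov β u` is bounded and measurable (Fubini measurability from the joint measurability of the flow on
`good × ℝ`), so integrate over `0 ≤ u ≤ s ≤ h`. -/
def TiltedCumulantComparison : Prop :=
  ∀ (ε : ℝ) (n : ℕ) (Φ : TFlow ε n) (μ : Measure (TPhase n)), IsProbabilityMeasure μ →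
    (∀ t, MeasurePreserving (Φ.flow t) μ μ) → μ Φ.goodᶜ = 0 →
    ∀ F : TPhase n → ℝ, Measurable F → (∃ C : ℝ, ∀ z, |F z| ≤ C) →
      ∀ (β h K : ℝ), 0 ≤ β → 0 < h →
        (∀ u ∈ Set.Icc (0 : ℝ) h, ∀ β' ∈ Set.Icc (0 : ℝ) β, |edgeCum Φ μ F β' u| ≤ K) →
        fejerInt Φ μ F β h ≤ fejerInt Φ μ F 0 h + β * K * h ^ 2 / 2

/-- Statement of `stub_squareWindowMonotone` — **window monotonicity of the quadratic (L²-Drude) functional**: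
same abstract data (`F` bounded measurable); for a window `w > 0` and an integer `m ≥ 1`,
`E_μ ((mw)⁻¹ J_{mw})² ≤ E_μ (w⁻¹ J_w)²` (in `∫⁻ … ofReal` currency). Proof plan: on good orbits
`(mw)⁻¹J_{mw} = m⁻¹ Σ_{k<m} (w⁻¹J_w)∘(Φ_w)^[k]` (`KineticWindowGronwallWindowSubadditivity.window_eq_cesaro`),
convexity of the square, and invariance of `μ` under the iterates of `Φ_w`. -/
def SquareWindowMonotone : Prop :=
  ∀ (ε : ℝ) (n : ℕ) (Φ : TFlow ε n) (μ : Measure (TPhase n)), IsProbabilityMeasure μ →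
    (∀ t, MeasurePreserving (Φ.flow t) μ μ) → μ Φ.goodᶜ = 0 →
    ∀ F : TPhase n → ℝ, Measurable F → (∃ C : ℝ, ∀ z, |F z| ≤ C) →
      ∀ (w : ℝ) (m : ℕ), 0 < w → 0 < m →
        ∫⁻ z, ENNReal.ofReal ((((m : ℝ) * w)⁻¹ * pathInt Φ F ((m : ℝ) * w) z) ^ 2) ∂μ ≤
          ∫⁻ z, ENNReal.ofReal ((w⁻¹ * pathInt Φ F w z) ^ 2) ∂μ

/-- Statement of `stub_tiltedThirdCumulantSublinear` — **THE OPEN STUB: the self-tilted edge third cumulant grows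
sublinearly in the kinetic window, uniformly in `N` and in the flow.** In the crux's frame (constant profiles
`a, θ, u₀`; `σ < σ₀`; an amplitude `κ > 0`; continuous `|φ| ≤ 1`, `|g| ≤ κ`, `g ⊥ span{1, v, |v|²}`): for every
`δ > 0` there is a kinetic scale `τ₀` such that for every window `τ ≥ τ₀` and all large `N`, every flow `Φ`, every
lag `u ∈ [0, h]` and tilt rate `β ∈ [0, 1/h]` (`h = τ(N+1)^{-1/3}`):
`|κ₃^{G_N^{β,u}}(F∘Φ_u, F, J_u)| ≤ δ · h · (N+1)`, `F = Σᵢ φ(xᵢ) g((vᵢ−u₀)/√θ)`, `G_N^{β,u} ∝ e^{βJ_u} G_N`.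
It consumes the crux's amplitude clause and `⊥ v`, `⊥ |v|²` (Gibbs-tilt near-misses of the crux's Disproof §3: at
large amplitude the self-tilted law condenses onto a drifted/heated homogeneous Gibbs law and `K₃ ≍ h·N`). Sources:
OllaVaradhanYau1993 §3; BGSSAnnals2023 (arXiv:2008.10403 Thm 4); BodineauEtAl2024 Thm 1.2. -/
def TiltedThirdCumulantSublinear : Prop :=
  ∀ (a θ : ℝ) (u₀ : V3), 0 < a → 0 < θ → ∃ σ₀ : ℝ, 0 < σ₀ ∧ ∀ σ : ℝ, 0 < σ → σ < σ₀ →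
    ∃ κ : ℝ, 0 < κ ∧ ∀ (φ : T3 → ℝ) (g : V3 → ℝ), Continuous φ → Continuous g →
      (∀ x, |φ x| ≤ 1) → (∀ v, |g v| ≤ κ) → Orthogonal g →
      ∀ δ : ℝ, 0 < δ → ∃ τ₀ : ℝ, 0 < τ₀ ∧ ∀ τ : ℝ, τ₀ ≤ τ → ∃ N₀ : ℕ, ∀ N : ℕ, N₀ ≤ N →
        ∀ Φ : Flow σ N, ∀ u ∈ Set.Icc (0 : ℝ) (window τ N), ∀ β ∈ Set.Icc (0 : ℝ) (window τ N)⁻¹,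
          |edgeCum Φ (gibbs σ a θ u₀ N Φ) (fluxObs θ u₀ φ g N) β u| ≤ δ * window τ N * ((N : ℝ) + 1)

/-- Statement of the bookkeeping stub `stub_selfTiltObjects` (S0) — **the tilt normalisation is junk-free**: for a
probability law `μ` carried by the good set and a bounded measurable `F`, the normalisation `Z = E_μ e^{βJ_u}` of the
self-tilted law obeys `e^{-|β||u|C} ≤ Z ≤ e^{|β||u|C}` (in particular `Z > 0`, so `tiltMean` never divides by zero).
This is the fact every stub file of the line uses first. -/
def SelfTiltObjectsBasic : Prop :=
  ∀ (ε : ℝ) (n : ℕ) (Φ : TFlow ε n) (μ : Measure (TPhase n)), IsProbabilityMeasure μ → μ Φ.goodᶜ = 0 →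
    ∀ F : TPhase n → ℝ, Measurable F → ∀ C : ℝ, (∀ z, |F z| ≤ C) → ∀ (β u : ℝ),
      Real.exp (-(|β| * (|u| * C))) ≤ ∫ z, tiltWeight Φ F β u z ∂μ ∧
        ∫ z, tiltWeight Φ F β u z ∂μ ≤ Real.exp (|β| * (|u| * C))

/-! ## Basic API (junk-free facts shared by the stub files) -/

/- Frame facts already landed elsewhere (dedup): `measurable_fluxObs`, `abs_fluxObs_le`
(`Theorems.CorrectorPressureDecayNegative.FastSectorSandwich.*`, module
`Theorems.CorrectorPressureDecay.Negative.FastSectorSandwichFrame`), `continuous_fluxObs`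
(`Theorems.CorrectorPressureDecayNegative.DiscreteWindow.continuous_fluxObs`), `gibbs_compl_good`
(`Theorems.InfluenceLocality.Negative.gibbs_compl_good`); they apply to the abbreviations above by unfolding,
or are re-derived inline (`fun_prop`; `localGibbsLaw_absolutelyContinuous … Φ.measure_compl_good`). -/

/-- The global Gibbs law is invariant under every hard-sphere flow map (tree theorem, PROVED:
`Theorems.measurePreserving_flow_localGibbsLaw_const` = route support HomogeneousInvariance 9621). -/
theorem gibbs_invariant (σ a θ : ℝ) (u₀ : V3) (N : ℕ) (Φ : Flow σ N) (t : ℝ) :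
    MeasurePreserving (Φ.flow t) (gibbs σ a θ u₀ N Φ) (gibbs σ a θ u₀ N Φ) :=
  Summit.AtomisticToContinuum.HydrodynamicLimit.Theorems.measurePreserving_flow_localGibbsLaw_const σ a θ u₀ N Φ t

section TiltAPI

variable {ε : ℝ} {n : ℕ}

/-- The path integral of a bounded observable is bounded by `|u| · C` at EVERY point (on a non-integrable
section the interval integral is the Bochner junk value `0`). -/
theorem abs_pathInt_le (Φ : TFlow ε n) {F : TPhase n → ℝ} {C : ℝ} (hC : ∀ z, |F z| ≤ C) (u : ℝ)
    (z : TPhase n) : |pathInt Φ F u z| ≤ |u| * C := by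
  have h := intervalIntegral.norm_integral_le_of_norm_le_const (a := (0 : ℝ)) (b := u)
    (f := fun r => F (Φ.flow r z)) (C := C) fun r _ => by
      simpa only [Real.norm_eq_abs] using hC (Φ.flow r z)
  simpa only [Real.norm_eq_abs, sub_zero, mul_comm C] using h

/-- The self-tilt weight is positive. -/
theorem tiltWeight_pos (Φ : TFlow ε n) (F : TPhase n → ℝ) (β u : ℝ) (z : TPhase n) :
    0 < tiltWeight Φ F β u z :=
  Real.exp_pos _

/-- Two-sided bound on the self-tilt weight of a bounded observable: `e^{-|β||u|C} ≤ e^{βJ_u} ≤ e^{|β||u|C}`. -/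
theorem tiltWeight_le (Φ : TFlow ε n) {F : TPhase n → ℝ} {C : ℝ} (hC : ∀ z, |F z| ≤ C) (β u : ℝ)
    (z : TPhase n) :
    Real.exp (-(|β| * (|u| * C))) ≤ tiltWeight Φ F β u z ∧
      tiltWeight Φ F β u z ≤ Real.exp (|β| * (|u| * C)) := by
  have h1 : |β * pathInt Φ F u z| ≤ |β| * (|u| * C) := by
    rw [abs_mul]
    exact mul_le_mul_of_nonneg_left (abs_pathInt_le Φ hC u z) (abs_nonneg _)
  have h2 := abs_le.1 h1
  exact ⟨Real.exp_le_exp.2 h2.1, Real.exp_le_exp.2 h2.2⟩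

/-- The path integral `z ↦ J_u(z)` of a measurable observable is `μ`-a.e. measurable for every law carried by
the good set (tree: `HardSphereFlow.aemeasurable_intervalIntegral_comp_flow_torus`). -/
theorem aemeasurable_pathInt (Φ : TFlow ε n) {μ : Measure (TPhase n)} (hμ : μ Φ.goodᶜ = 0)
    {F : TPhase n → ℝ} (hF : Measurable F) (u : ℝ) : AEMeasurable (pathInt Φ F u) μ :=
  Φ.aemeasurable_intervalIntegral_comp_flow_torus hF 0 u hμ

/-- The self-tilt weight of a measurable observable is `μ`-a.e. measurable for every law carried by the good set. -/
theorem aemeasurable_tiltWeight (Φ : TFlow ε n) {μ : Measure (TPhase n)} (hμ : μ Φ.goodᶜ = 0)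
    {F : TPhase n → ℝ} (hF : Measurable F) (β u : ℝ) : AEMeasurable (tiltWeight Φ F β u) μ :=
  Real.measurable_exp.comp_aemeasurable ((aemeasurable_pathInt Φ hμ hF u).const_mul β)

/-- At `β = 0` the tilt weight is `1`. -/
@[simp] theorem tiltWeight_zero (Φ : TFlow ε n) (F : TPhase n → ℝ) (u : ℝ) (z : TPhase n) :
    tiltWeight Φ F 0 u z = 1 := by
  simp [tiltWeight]

/-- At `β = 0` the tilted mean under a probability law is the plain mean. -/
theorem tiltMean_zero (Φ : TFlow ε n) (μ : Measure (TPhase n)) [IsProbabilityMeasure μ]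
    (F : TPhase n → ℝ) (u : ℝ) (X : TPhase n → ℝ) : tiltMean Φ μ F 0 u X = ∫ z, X z ∂μ := by
  simp [tiltMean]

/-- The self-tilt weight of a bounded measurable observable is integrable against every finite law carried by
the good set. -/
theorem integrable_tiltWeight (Φ : TFlow ε n) {μ : Measure (TPhase n)} [IsFiniteMeasure μ]
    (hμ : μ Φ.goodᶜ = 0) {F : TPhase n → ℝ} (hF : Measurable F) {C : ℝ} (hC : ∀ z, |F z| ≤ C) (β u : ℝ) :
    Integrable (tiltWeight Φ F β u) μ :=
  (integrable_const (Real.exp (|β| * (|u| * C)))).mono'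
    (aemeasurable_tiltWeight Φ hμ hF β u).aestronglyMeasurable
    (ae_of_all _ fun z => by
      rw [Real.norm_eq_abs, abs_of_pos (tiltWeight_pos Φ F β u z)]
      exact (tiltWeight_le Φ hC β u z).2)

/-- **Registered bookkeeping stub S0** (`stub_selfTiltObjects`): the two-sided bound
`e^{-|β||u|C} ≤ E_μ e^{βJ_u} ≤ e^{|β||u|C}` on the tilt normalisation (monotonicity of the integral against the
pointwise bounds `tiltWeight_le`, `μ` a probability law). -/
theorem stub_selfTiltObjects : SelfTiltObjectsBasic := by
  intro ε n Φ μ hμP hμ F hF C hC β u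
  have hint : Integrable (tiltWeight Φ F β u) μ := integrable_tiltWeight Φ hμ hF hC β u
  constructor
  · calc Real.exp (-(|β| * (|u| * C))) = ∫ _z, Real.exp (-(|β| * (|u| * C))) ∂μ := by simp
      _ ≤ ∫ z, tiltWeight Φ F β u z ∂μ :=
          integral_mono (integrable_const _) hint fun z => (tiltWeight_le Φ hC β u z).1
  · calc ∫ z, tiltWeight Φ F β u z ∂μ ≤ ∫ _z, Real.exp (|β| * (|u| * C)) ∂μ :=
          integral_mono hint (integrable_const _) fun z => (tiltWeight_le Φ hC β u z).2
      _ = Real.exp (|β| * (|u| * C)) := by simp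

end TiltAPI

end Summit.AtomisticToContinuum.HydrodynamicLimit.Theorems.SelfTilt

end
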